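import Summits.HodgeConjecture.HodgeConjecture.Theorems.R90S1RamifiedOddShellFibres                  -- ★ (this seat) `heisZFibreOne_eq_zero_ram'` (every shell-one fibre vanishes, letter-free)
import HarnessLib

/-!
# R90 · S1 ∕ U4Keys leaf (U4f-χ₁-ram-one-d0B) — THE RAMIFIED SHELL-ONE FIBRE FUNCTION IS ZERO AND SO IS ITS `x`-INTEGRAL:
# `(x ↦ ∫_{y : |heisZ σ x y|_w = q_w} E(heisZ σ x y) dμ⁻) = 0`, `∫_R (fibre) dμR = 0` — the `x`-side of the ramified odd-shell identity `h1 : ∫_{Sh 1} F₀ = 0`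
# [Keys1984 §5, §7 Thm (2) (d); Rogawski1990 §1.10, §12.2 (2); PAPER-Z3-DepthZeroRamified §1 (R90-C10-p05 (g0), r01-screened)]

Cell `hodgecm-mathlib`, SLAB R90-TF, section S1 «Ch. 12 local», crux H413 = `stmt-HodgeConjecture-24833` (lane `--supports … --as helper`), route HCCMUnconditional; prover seat
`hodgecm-mathlib-R90-C10-p05` (g0); socket of record S1#3′ = K2E3 leaf (U4f-χ₁-ram-one) ⊇ U4Keys :155 (depth 0, Branch B).  THEOREMS ONLY (no definition ∕ instance ∕ notation ∕
named fact ∕ `sorry`); ★-only imports.  FRAME (v1 spellings): `R := LocalRing L v`, `σ := conjLocal L c v`, `R⁻ = skewPart σ`, chart `z = heisZ σ x y`; `v` non-split (`hw`), `w ∣ v`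
RAMIFIED (`he`), `|2|_w = 1` (`h2w`, `[Invertible (2 : R)]`); the :155 letters `hdepth`, `hram`; `μ⁻ = μY` a regular additive Haar measure on `R⁻`, `μR` any measure on `R`.
THE POINT.  The companion of ★ `R90S1RamifiedShellZeroFibreFunction` for the odd shell: ★ `heisZFibreOne_eq_zero_ram'` pointwise gives the zero function of `x`, whose `μR`-integral is `0`.
Once the Heisenberg-chart assembler identifies `∫_{Sh 1} F₀ dμ_N` with this iterated integral, `h1_ram : ∫_{Sh 1} F₀ = 0` of ★ `exists_eta_of_reducible_of_shellIdentities_ram` follows.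
* **`heisZFibreOne_fun_eq_zero_ram`**, **`integral_heisZFibreOne_eq_zero_ram`**.
HONEST LABEL.  HC_CM is proved only modulo the 7 printed citations (2 remaining named inputs: hLiu418 = `stmt-HodgeConjecture-24832`, h413 = `stmt-HodgeConjecture-24833`) until rung 0
closes; count-neutral — this file does NOT pay the leaf; no printed citation is discharged.

## References
* [Keys1984] D. Keys, *Principal series representations of special unitary groups over local fields*, Compositio Math. 51 (1984), §5, §7 Theorem (2) (d) p. 126.
* [Rogawski1990] J. D. Rogawski, *Automorphic Representations of Unitary Groups in Three Variables*, Ann. of Math. Stud. 123 (1990), §1.10 p. 9, §12.2 (2) p. 173.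
-/

set_option autoImplicit false
-- the mandated namespace has the single-problem summit's repeated segment (`HodgeConjecture.HodgeConjecture`)
set_option linter.dupNamespace false

noncomputable section

open NumberField IsDedekindDomain MeasureTheory Measure Topology Set
open scoped NNReal ENNReal
open Literature.NumberTheory Literature.NumberTheory.Automorphic Literature.NumberTheory.Automorphic.UnitaryGroup

namespace Summit.HodgeConjecture.HodgeConjecture.R90.S1

open Summit.HodgeConjecture.HodgeConjecture.Cruxes.H413

variable (L : Type) [Field L] [NumberField L] [IsCMField L] (v : HeightOneSpectrum (𝓞 ↥(maximalRealSubfield L)))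
  (w : PlacesOver L v) (hw : IsCMField.complexConj L • w.1 = w.1)

set_option linter.overlappingInstances false in  -- `[μY.IsAddHaarMeasure] [μY.Regular]` are the binders of ★ `heisZFibreOne_eq_zero_ram'`
include hw in
open scoped Classical in
/-- **THE RAMIFIED SHELL-ONE FIBRE FUNCTION IS THE ZERO FUNCTION** of `x ∈ R` (★ `heisZFibreOne_eq_zero_ram'` pointwise). [cite: Keys1984, §5, §7 Theorem (2) (d) p. 126]
[cite: Rogawski1990, §1.10 p. 9, §12.2 (2) p. 173] -/
theorem heisZFibreOne_fun_eq_zero_ram [Invertible (2 : LocalRing L v)] [MeasurableSpace (LocalRing L v)] [BorelSpace (LocalRing L v)]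
    (he : v.asIdeal.ramificationIdx' w.1.asIdeal ≠ 1) (h2w : Valued.v (2 : w.1.adicCompletion L) = 1) (χ₁ : (LocalRing L v)ˣ →* ℂˣ)
    (hdepth : ∀ u : (LocalRing L v)ˣ, (∀ w' : PlacesOver L v, Valued.v (((u : LocalRing L v) w') - 1) < 1) → χ₁ u = 1)
    (hram : ¬ ∀ u ∈ (Submonoid.pi Set.univ (fun w' : PlacesOver L v => (w'.1.adicCompletionIntegers L).toSubring.toSubmonoid)).units, χ₁ u = 1)
    (μY : Measure ↥(HeisRing.skewPart (conjLocal L (IsCMField.complexConj L) v))) [μY.IsAddHaarMeasure] [μY.Regular] :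
    (fun x : LocalRing L v => ∫ y in {y : ↥(HeisRing.skewPart (conjLocal L (IsCMField.complexConj L) v)) |
        Valued.v ((HeisRing.heisZ (conjLocal L (IsCMField.complexConj L) v) x (y : LocalRing L v)) w) = WithZero.exp (1 : ℤ)},
        (fun r : LocalRing L v => if h : IsUnit r then ((χ₁ h.unit : ℂˣ) : ℂ) else 0)
          (HeisRing.heisZ (conjLocal L (IsCMField.complexConj L) v) x (y : LocalRing L v)) ∂μY) = 0 :=
  funext fun x => heisZFibreOne_eq_zero_ram' L v w hw he h2w χ₁ hdepth hram μY x

set_option linter.overlappingInstances false in  -- as above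
include hw in
open scoped Classical in
/-- **… AND ITS `x`-INTEGRAL VANISHES** for any measure `μR` on `R`: `∫_R (∫_{y : |heisZ σ x y|_w = q_w} E(heisZ σ x y) dμ⁻) dμR(x) = 0` — the `x`-side of the ramified odd-shell
identity `h1`. [cite: Keys1984, §5, §7 Theorem (2) (d) p. 126] [cite: Rogawski1990, §1.10 p. 9, §12.2 (2) p. 173] -/
theorem integral_heisZFibreOne_eq_zero_ram [Invertible (2 : LocalRing L v)] [MeasurableSpace (LocalRing L v)] [BorelSpace (LocalRing L v)]
    (he : v.asIdeal.ramificationIdx' w.1.asIdeal ≠ 1) (h2w : Valued.v (2 : w.1.adicCompletion L) = 1) (χ₁ : (LocalRing L v)ˣ →* ℂˣ)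
    (hdepth : ∀ u : (LocalRing L v)ˣ, (∀ w' : PlacesOver L v, Valued.v (((u : LocalRing L v) w') - 1) < 1) → χ₁ u = 1)
    (hram : ¬ ∀ u ∈ (Submonoid.pi Set.univ (fun w' : PlacesOver L v => (w'.1.adicCompletionIntegers L).toSubring.toSubmonoid)).units, χ₁ u = 1)
    (μY : Measure ↥(HeisRing.skewPart (conjLocal L (IsCMField.complexConj L) v))) [μY.IsAddHaarMeasure] [μY.Regular] (μR : Measure (LocalRing L v)) :
    ∫ x, (∫ y in {y : ↥(HeisRing.skewPart (conjLocal L (IsCMField.complexConj L) v)) |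
        Valued.v ((HeisRing.heisZ (conjLocal L (IsCMField.complexConj L) v) x (y : LocalRing L v)) w) = WithZero.exp (1 : ℤ)},
        (fun r : LocalRing L v => if h : IsUnit r then ((χ₁ h.unit : ℂˣ) : ℂ) else 0)
          (HeisRing.heisZ (conjLocal L (IsCMField.complexConj L) v) x (y : LocalRing L v)) ∂μY) ∂μR = 0 := by
  have hfun := heisZFibreOne_fun_eq_zero_ram L v w hw he h2w χ₁ hdepth hram μY
  rw [show (fun x : LocalRing L v => ∫ y in {y : ↥(HeisRing.skewPart (conjLocal L (IsCMField.complexConj L) v)) |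
        Valued.v ((HeisRing.heisZ (conjLocal L (IsCMField.complexConj L) v) x (y : LocalRing L v)) w) = WithZero.exp (1 : ℤ)},
        (fun r : LocalRing L v => if h : IsUnit r then ((χ₁ h.unit : ℂˣ) : ℂ) else 0)
          (HeisRing.heisZ (conjLocal L (IsCMField.complexConj L) v) x (y : LocalRing L v)) ∂μY) = 0 from hfun]
  exact integral_zero _ _

end Summit.HodgeConjecture.HodgeConjecture.R90.S1

end
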